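import Summits.Ventures.Crystal3D.Theorems.StickyWulffConstantPolycrystalWulffBoundZoneRunsChimera

/-!
# Lower quantile functions of a continuous cumulative profile, and of the abscissa marginal of a
# bounded planar set (engine part 2a for the charged zone rung, line `PolyDensity`, crux `stmt-Ventures-19482`)

Route `StickyWulffConstant` of the venture `Summits/Ventures/Crystal3D`, second prover lane (poly-p2,
gen 9).  The slice-runs engine `chimera3_sliceRuns_brunnMinkowski` (`…ZoneRunsChimera`) is fed, slice
by slice, with abscissa WINDOWS carrying prescribed masses of the bodies' planar sections; these are
consecutive quantile windows of the sections' abscissa marginals.  This file provides them without a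
two-dimensional port of poly-p2 g8's `exists_lowerQuantile_of_isCompact`:
* `exists_lowerQuantile_of_cdf` — pure real analysis: a continuous monotone profile `Φ` with
  `Φ(−(R+1)) = 0`, `Φ(R+1) = M` has a LOWER quantile function `q` (`Φ (q σ) = σ M`, `|q σ| ≤ R+1`,
  and `q σ ≤ t` whenever `σ M ≤ Φ t`, `t ≥ −(R+1)`);
* `lowerQuantile_le_add_of_cdf_shift` — two profiles with `Φ' t ≤ Φ (t + δ)` have `q σ ≤ q' σ + δ`;
* `abscissaCdf_lipschitz`, `exists_lowerQuantile_planar` — for a measurable planar set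
  `S ⊆ closedBall 0 R` (sup norm) the abscissa profile `x ↦ |S ∩ {p₁ < x}|` is `2R`-Lipschitz, hence
  has a lower quantile function, with the window masses `|S ∩ {q σ₁ < p₁ < q σ₂}| ≥ (σ₂ − σ₁)|S|`.
WHAT THIS IS NOT: the zone rung (trimming, runs, assembly — memo P-TWIN-g9 §8); the crux is not claimed. -/

noncomputable section

namespace Summit.Ventures.Crystal3D.Theorems.Chimera

open MeasureTheory Set
open scoped ENNReal Topology

/-! ### Lower quantiles of a continuous monotone profile -/

/-- **Lower quantile function of a continuous monotone profile.** -/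
theorem exists_lowerQuantile_of_cdf {Φ : ℝ → ℝ} (hmono : Monotone Φ) (hcont : Continuous Φ)
    {R M : ℝ} (hR : 0 ≤ R) (hlow : Φ (-(R + 1)) = 0) (hhigh : Φ (R + 1) = M) :
    ∃ q : ℝ → ℝ, (∀ σ, |q σ| ≤ R + 1) ∧
      (∀ σ, 0 ≤ σ → σ ≤ 1 → Φ (q σ) = σ * M) ∧
      (∀ σ t, 0 ≤ σ → σ ≤ 1 → -(R + 1) ≤ t → σ * M ≤ Φ t → q σ ≤ t) := by
  have hM : 0 ≤ M := by rw [← hhigh, ← hlow]; exact hmono (by linarith)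
  -- the admissible levels for `σ`
  set T : ℝ → Set ℝ := fun σ => {t : ℝ | -(R + 1) ≤ t ∧ t ≤ R + 1 ∧ σ * M ≤ Φ t} with hT
  have hTne : ∀ σ, σ ≤ 1 → (T σ).Nonempty := fun σ hσ =>
    ⟨R + 1, by linarith, le_rfl, by rw [hhigh]; nlinarith⟩
  have hTbdd : ∀ σ, BddBelow (T σ) := fun σ => ⟨-(R + 1), fun t ht => ht.1⟩
  have hTclosed : ∀ σ, IsClosed (T σ) := by
    intro σ
    have : T σ = Icc (-(R + 1)) (R + 1) ∩ Φ ⁻¹' Ici (σ * M) := by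
      ext t; simp [hT, and_assoc]
    rw [this]
    exact isClosed_Icc.inter (isClosed_Ici.preimage hcont)
  classical
  refine ⟨fun σ => if 0 ≤ σ ∧ σ ≤ 1 then sInf (T σ) else 0, ?_, ?_, ?_⟩
  · intro σ
    dsimp only
    by_cases h : 0 ≤ σ ∧ σ ≤ 1
    · rw [if_pos h]
      have hmem := (hTclosed σ).csInf_mem (hTne σ h.2) (hTbdd σ)
      exact abs_le.2 ⟨hmem.1, hmem.2.1⟩
    · rw [if_neg h, abs_zero]; linarith
  · intro σ h0 h1
    dsimp only
    rw [if_pos ⟨h0, h1⟩]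
    have hmem := (hTclosed σ).csInf_mem (hTne σ h1) (hTbdd σ)
    refine le_antisymm ?_ hmem.2.2
    -- if `Φ (inf T) > σ M`, continuity gives a smaller admissible level
    by_contra hgt'
    have hgt := lt_of_not_ge hgt'
    set t₀ := sInf (T σ) with ht₀
    by_cases hbot : t₀ = -(R + 1)
    · rw [hbot, hlow] at hgt
      nlinarith
    · have hlt : -(R + 1) < t₀ := lt_of_le_of_ne hmem.1 (Ne.symm hbot)
      -- continuity at `t₀` from the left
      have hev : ∀ᶠ t in 𝓝 t₀, σ * M < Φ t :=
        hcont.continuousAt.eventually (isOpen_Ioi.mem_nhds hgt)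
      obtain ⟨ε, hε, hball⟩ := Metric.eventually_nhds_iff.1 hev
      set t₁ := max (-(R + 1)) (t₀ - ε / 2) with ht₁
      have ht₁lt : t₁ < t₀ := max_lt hlt (by linarith)
      have ht₁mem : t₁ ∈ T σ := by
        refine ⟨le_max_left _ _, by linarith [hmem.2.1], ?_⟩
        have : dist t₁ t₀ < ε := by
          rw [Real.dist_eq, abs_sub_comm, abs_of_pos (by linarith)]
          have : t₀ - ε / 2 ≤ t₁ := le_max_right _ _
          linarith
        exact (hball this).le
      have := csInf_le (hTbdd σ) ht₁mem
      linarith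
  · intro σ t h0 h1 ht hΦ
    dsimp only
    rw [if_pos ⟨h0, h1⟩]
    by_cases htR : t ≤ R + 1
    · exact csInf_le (hTbdd σ) ⟨ht, htR, hΦ⟩
    · have hmem := (hTclosed σ).csInf_mem (hTne σ h1) (hTbdd σ)
      linarith [hmem.2.1]

/-- **Quantile mismatch from a profile shift.**  If `Φ' t ≤ Φ (t + δ)` for all `t` (`δ ≥ 0`), `q'`
attains the levels of `Φ'` exactly and `q` is the lower quantile of `Φ`, then `q σ ≤ q' σ + δ`. -/
theorem lowerQuantile_le_add_of_cdf_shift {Φ Φ' : ℝ → ℝ} {R M δ : ℝ} (hδ : 0 ≤ δ) (q q' : ℝ → ℝ)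
    (hq'val : ∀ σ, 0 ≤ σ → σ ≤ 1 → Φ' (q' σ) = σ * M) (hq'bd : ∀ σ, |q' σ| ≤ R + 1)
    (hqmin : ∀ σ t, 0 ≤ σ → σ ≤ 1 → -(R + 1) ≤ t → σ * M ≤ Φ t → q σ ≤ t)
    (hshift : ∀ t, Φ' t ≤ Φ (t + δ)) :
    ∀ σ, 0 ≤ σ → σ ≤ 1 → q σ ≤ q' σ + δ := by
  intro σ h0 h1
  refine hqmin σ (q' σ + δ) h0 h1 (by linarith [(abs_le.1 (hq'bd σ)).1]) ?_
  rw [← hq'val σ h0 h1]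
  exact hshift _

/-! ### The abscissa profile of a bounded planar set -/

/-- The abscissa profile `x ↦ |S ∩ {p₁ < x}|` of a measurable planar set in the box
`closedBall 0 R` (sup norm) grows by at most `2R·(x' − x)` between `x ≤ x'`. -/
theorem abscissaCdf_sub_le {S : Set (ℝ × ℝ)} {R : ℝ} (hR : 0 ≤ R)
    (hSR : S ⊆ Metric.closedBall (0 : ℝ × ℝ) R) {x x' : ℝ} (hxx' : x ≤ x') :
    (volume (S ∩ {p : ℝ × ℝ | p.1 < x'})).toReal - (volume (S ∩ {p : ℝ × ℝ | p.1 < x})).toReal ≤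
      2 * R * (x' - x) := by
  have hfin : ∀ y, volume (S ∩ {p : ℝ × ℝ | p.1 < y}) ≠ ⊤ := fun y =>
    ne_top_of_le_ne_top (measure_closedBall_lt_top (x := (0 : ℝ × ℝ)) (r := R)).ne
      (measure_mono (inter_subset_left.trans hSR))
  have hsplit : S ∩ {p : ℝ × ℝ | p.1 < x'} ⊆ (S ∩ {p : ℝ × ℝ | p.1 < x}) ∪ (Icc x x' ×ˢ Icc (-R) R) := by
    rintro p ⟨hpS, hpx'⟩
    by_cases hpx : p.1 < x
    · exact Or.inl ⟨hpS, hpx⟩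
    · refine Or.inr ⟨⟨not_lt.1 hpx, le_of_lt hpx'⟩, ?_⟩
      have hp := hSR hpS
      rw [Metric.mem_closedBall, dist_zero_right, Prod.norm_def] at hp
      have h2 : |p.2| ≤ R := (le_max_right _ _).trans hp
      exact ⟨(abs_le.1 h2).1, (abs_le.1 h2).2⟩
  have hbox : volume (Icc x x' ×ˢ Icc (-R) R) = ENNReal.ofReal ((x' - x) * (2 * R)) := by
    rw [Measure.volume_eq_prod, Measure.prod_prod, Real.volume_Icc, Real.volume_Icc,
      ← ENNReal.ofReal_mul (by linarith)]
    ring_nf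
  have hle : volume (S ∩ {p : ℝ × ℝ | p.1 < x'}) ≤
      volume (S ∩ {p : ℝ × ℝ | p.1 < x}) + ENNReal.ofReal ((x' - x) * (2 * R)) :=
    (measure_mono hsplit).trans ((measure_union_le _ _).trans (by rw [hbox]))
  have h := ENNReal.toReal_mono (ENNReal.add_ne_top.2 ⟨hfin x, ENNReal.ofReal_ne_top⟩) hle
  rw [ENNReal.toReal_add (hfin x) ENNReal.ofReal_ne_top,
    ENNReal.toReal_ofReal (by nlinarith)] at h
  linarith

/-- **Lower quantile function of the abscissa marginal of a bounded planar set** of area `M`. -/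
theorem exists_lowerQuantile_planar {S : Set (ℝ × ℝ)} {R : ℝ} (hR : 0 ≤ R)
    (hSR : S ⊆ Metric.closedBall (0 : ℝ × ℝ) R) {M : ℝ} (hM0 : 0 ≤ M)
    (hSM : volume S = ENNReal.ofReal M) :
    ∃ q : ℝ → ℝ, (∀ σ, |q σ| ≤ R + 1) ∧
      (∀ σ, 0 ≤ σ → σ ≤ 1 → (volume (S ∩ {p : ℝ × ℝ | p.1 < q σ})).toReal = σ * M) ∧
      (∀ σ t, 0 ≤ σ → σ ≤ 1 → -(R + 1) ≤ t →
        ENNReal.ofReal (σ * M) ≤ volume (S ∩ {p : ℝ × ℝ | p.1 < t}) → q σ ≤ t) ∧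
      (∀ σ₁ σ₂, 0 ≤ σ₁ → σ₁ ≤ σ₂ → σ₂ ≤ 1 →
        ENNReal.ofReal ((σ₂ - σ₁) * M) ≤ volume (S ∩ {p : ℝ × ℝ | q σ₁ < p.1 ∧ p.1 < q σ₂})) := by
  set Φ : ℝ → ℝ := fun x => (volume (S ∩ {p : ℝ × ℝ | p.1 < x})).toReal with hΦ
  have hfin : ∀ y, volume (S ∩ {p : ℝ × ℝ | p.1 < y}) ≠ ⊤ := fun y =>
    ne_top_of_le_ne_top (measure_closedBall_lt_top (x := (0 : ℝ × ℝ)) (r := R)).ne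
      (measure_mono (inter_subset_left.trans hSR))
  have hmono : Monotone Φ := fun x x' hxx' =>
    ENNReal.toReal_mono (hfin x') (measure_mono fun p hp => ⟨hp.1, lt_of_lt_of_le hp.2 hxx'⟩)
  have hcont : Continuous Φ := by
    have hlip : LipschitzWith (Real.toNNReal (2 * R)) Φ := by
      refine LipschitzWith.of_le_add_mul (Real.toNNReal (2 * R)) fun x x' => ?_
      rw [Real.coe_toNNReal _ (by positivity)]
      rcases le_total x x' with h | h
      · have h1 := hmono h
        have hd : 0 ≤ dist x x' := dist_nonneg
        nlinarith
      · have h1 := abscissaCdf_sub_le hR hSR h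
        rw [Real.dist_eq, abs_of_nonneg (by linarith)]
        simp only [hΦ] at h1 ⊢
        linarith
    exact hlip.continuous
  have hinS : ∀ p ∈ S, |p.1| ≤ R := fun p hp => by
    have h := hSR hp
    rw [Metric.mem_closedBall, dist_zero_right, Prod.norm_def] at h
    exact (le_max_left _ _).trans h
  have hlow : Φ (-(R + 1)) = 0 := by
    have : S ∩ {p : ℝ × ℝ | p.1 < -(R + 1)} = ∅ := by
      ext p
      simp only [mem_inter_iff, mem_setOf_eq, mem_empty_iff_false, iff_false, not_and, not_lt]
      intro hp
      linarith [(abs_le.1 (hinS p hp)).1]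
    simp only [hΦ, this, measure_empty, ENNReal.toReal_zero]
  have hhigh : Φ (R + 1) = M := by
    have : S ∩ {p : ℝ × ℝ | p.1 < R + 1} = S := by
      ext p
      simp only [mem_inter_iff, mem_setOf_eq, and_iff_left_iff_imp]
      intro hp
      linarith [(abs_le.1 (hinS p hp)).2]
    simp only [hΦ, this, hSM, ENNReal.toReal_ofReal hM0]
  obtain ⟨q, hqbd, hqval, hqmin⟩ := exists_lowerQuantile_of_cdf hmono hcont hR hlow hhigh
  refine ⟨q, hqbd, hqval, fun σ t h0 h1 ht hle => hqmin σ t h0 h1 ht ?_, ?_⟩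
  · have := ENNReal.toReal_mono (hfin t) hle
    rwa [ENNReal.toReal_ofReal (mul_nonneg h0 hM0)] at this
  · intro σ₁ σ₂ h1 h12 h2
    -- the window mass: `Φ(q σ₂) − |S ∩ {p₁ ≤ q σ₁}| = (σ₂ − σ₁) M` (the line `p₁ = q σ₁` is null)
    have hline : volume (S ∩ {p : ℝ × ℝ | p.1 = q σ₁}) = 0 := by
      refine measure_mono_null inter_subset_right ?_
      have : {p : ℝ × ℝ | p.1 = q σ₁} = {q σ₁} ×ˢ (univ : Set ℝ) := by
        ext p; simp
      rw [this, Measure.volume_eq_prod, Measure.prod_prod, Real.volume_singleton, zero_mul]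
    have hdecomp : S ∩ {p : ℝ × ℝ | p.1 < q σ₂} ⊆
        (S ∩ {p : ℝ × ℝ | q σ₁ < p.1 ∧ p.1 < q σ₂}) ∪
          ((S ∩ {p : ℝ × ℝ | p.1 < q σ₁}) ∪ (S ∩ {p : ℝ × ℝ | p.1 = q σ₁})) := by
      rintro p ⟨hpS, hp2⟩
      rcases lt_trichotomy (q σ₁) p.1 with h | h | h
      · exact Or.inl ⟨hpS, h, hp2⟩
      · exact Or.inr (Or.inr ⟨hpS, h.symm⟩)
      · exact Or.inr (Or.inl ⟨hpS, h⟩)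
    have hle := (measure_mono (μ := volume) hdecomp).trans ((measure_union_le _ _).trans
      (add_le_add le_rfl (measure_union_le _ _)))
    rw [hline, add_zero] at hle
    have h2v : volume (S ∩ {p : ℝ × ℝ | p.1 < q σ₂}) = ENNReal.ofReal (σ₂ * M) := by
      rw [← hqval σ₂ (by linarith) h2, ENNReal.ofReal_toReal (hfin _)]
    have h1v : volume (S ∩ {p : ℝ × ℝ | p.1 < q σ₁}) = ENNReal.ofReal (σ₁ * M) := by
      rw [← hqval σ₁ h1 (by linarith), ENNReal.ofReal_toReal (hfin _)]
    rw [h2v, h1v] at hle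
    have hsub : ENNReal.ofReal ((σ₂ - σ₁) * M) = ENNReal.ofReal (σ₂ * M) - ENNReal.ofReal (σ₁ * M) := by
      rw [← ENNReal.ofReal_sub _ (mul_nonneg h1 hM0)]; ring_nf
    rw [hsub]
    exact tsub_le_iff_right.2 hle

end Summit.Ventures.Crystal3D.Theorems.Chimera

end
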